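import Mathlib
import HarnessLib
import Literature.NumberTheory.Automorphic.GL2RSLFactorCharacter

/-!
# Local representation theory at conductor one, auxiliary file 2: Jacquet-module eigenclasses
# from `L`-degrees, and the exponents of a principal series of `GL₂(F)` from two eigenclasses
(crux stmt-Langlands-15898 `QuarterDeficit1951.CorrespondentFingerprint`, line `Sketch`, stub
`stub_local1951_reptheory` (C3); helper `--supports`)

Let `F` be a non-archimedean local field, `π` a smooth representation of `GL₂(F)` on `V` with
finite-dimensional Jacquet module `V_N`, `H = d(𝒪ˣ, 1)`, `ψ ≠ 1` continuous, `χ : Fˣ → ℂˣ` smooth.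

* `exists_ne_zero_jacquetGL_eq_self_of_hasRSLFactor` — if for every invariant Radon full-support
  `ν` some JPSS polynomial of `π × 1` has degree `≥ 1`, then `V_N` contains a non-zero class fixed
  by `d(𝒪ˣ, 1)` (pole bound `natDegree_le_finrank_of_hasRSLFactor`: `1 ≤ deg P ≤ dim M`, `M` the
  image of `V^H`);
* `exists_ne_zero_jacquetGL_eq_smul_of_hasRSLFactor_glOneRep` — the same for `π × χ⁻¹` gives a
  non-zero `(d(𝒪ˣ,1), χ)`-EIGENclass (`L(s, π × χ⁻¹) = L(s, (π ⊗ χ⁻¹∘det) × 1)`,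
  `hasRSLFactor_glOneRep_iff_twist`; the twist does not change the restriction to `N`,
  `restrictUnipotentGL_twist_det`);
* `levi_exponents_of_jacquet_eigenclasses` — **the exponents of `I(σ)` from two eigenclasses**:
  for a smooth scalar datum `σ` on a line `W` and the Jacquet module `I(σ)_N` of the principal
  series, if `I(σ)_N` contains a non-zero `d(𝒪ˣ,1)`-fixed class `y₁` and a non-zero
  `(d(𝒪ˣ,1), χ)`-eigenclass `y₂` with `χ(u₀) ≠ 1` for some unit `u₀`, then either
  `σ(proj d(u,1)) = 1, σ(proj d(1,u)) = χ(u)` for all units `u`, or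
  `σ(proj d(u,1)) = χ(u), σ(proj d(1,u)) = 1` — read off from the closed-cell exponent
  (evaluation at `1`, `toFun_one_parabolicIndGL_parabolic`) and the open-cell exponent
  (`parabolicIndGL_diagGL2_cellSection`) of the geometric lemma (Bernstein–Zelevinsky 1977,
  Thm. 5.2; Jacquet–Langlands 1970, Prop. 3.5).

References: [JacquetLanglands1970] Prop. 3.5, Thm. 2.18; [BernsteinZelevinskyASENS1977] Thm. 5.2;
[Casselman1973] Thm. 1; [BushnellHenniart2006] §9.11.
-/

set_option linter.dupNamespace false -- project-wide option (lakefile weak.linter.dupNamespace); `Summit.Langlands.Langlands` is the mandated namespace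

noncomputable section

open scoped MatrixGroups Matrix NNReal
open Literature.NumberTheory.Automorphic ValuativeRel MeasureTheory Polynomial
  Literature.NumberTheory.GaloisRepresentations.IsNonarchimedeanLocalField

namespace Summit.Langlands.Langlands.Theorems.CorrespondentFingerprint

/-! ### Eigenclasses in the Jacquet module from `L`-degrees -/

section Eigenclasses

variable {F : Type*} [Field F] [ValuativeRel F] [TopologicalSpace F] [IsNonarchimedeanLocalField F]
  {V : Type*} [AddCommGroup V] [Module ℂ V] (π : Representation ℂ (GL (Fin 2) F) V)
  [MeasurableSpace F] [BorelSpace F]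
  [MeasurableSpace (GL (Fin 1) F ⧸ upperUnitriangular (Fin 1) F)]
  [BorelSpace (GL (Fin 1) F ⧸ upperUnitriangular (Fin 1) F)]

/-- **`deg L(s, π × 1) ≥ 1` gives a non-zero `d(𝒪ˣ, 1)`-fixed class in the Jacquet module**
(pole bound: `deg P ≤ dim M`, `M ≤ V_N` the image of the `d(𝒪ˣ,1)`-fixed vectors, whose classes
are fixed by `d(𝒪ˣ, 1)`). [cite: JacquetLanglands1970, Prop. 2.10, Prop. 3.5] -/
theorem exists_ne_zero_jacquetGL_eq_self_of_hasRSLFactor (hπ : π.IsSmooth) {ψ : AddChar F Circle}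
    (hψ : ψ.IsContinuousNontrivial)
    [FiniteDimensional ℂ (Representation.restrictUnipotentGL F (id : Fin 2 → Fin 2) π).Coinvariants]
    (hL : ∀ (ν : Measure (GL (Fin 1) F ⧸ upperUnitriangular (Fin 1) F))
      [SMulInvariantMeasure (GL (Fin 1) F) (GL (Fin 1) F ⧸ upperUnitriangular (Fin 1) F) ν]
      [IsFiniteMeasureOnCompacts ν] [ν.IsOpenPosMeasure],
      ∃ P : ℂ[X], HasRSLFactor Nat.one_lt_two π (Representation.trivial ℂ (GL (Fin 1) F) ℂ) ψ ν P ∧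
        1 ≤ P.natDegree) :
    ∃ x : (Representation.restrictUnipotentGL F (id : Fin 2 → Fin 2) π).Coinvariants, x ≠ 0 ∧
      ∀ u : Fˣ, valuation F (u : F) = 1 →
        Representation.jacquetGL F (id : Fin 2 → Fin 2) π (leviProjection F (id : Fin 2 → Fin 2)
          ⟨diagGL2 u 1, diagGL2_mem_standardParabolicGL_fin_two u 1⟩) x = x := by
  obtain ⟨H, hH⟩ := exists_subgroup_diagGL2_units (F := F)
  obtain ⟨ν, hinv, hfin, hpos, hC⟩ := natDegree_le_finrank_of_hasRSLFactor π hπ hψ H hH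
  haveI := hinv; haveI := hfin; haveI := hpos
  obtain ⟨P, hP, hdeg⟩ := hL ν
  have hM := hdeg.trans (hC P hP)
  have hM0 : Submodule.map (Representation.Coinvariants.mk
      (Representation.restrictUnipotentGL F (id : Fin 2 → Fin 2) π)) (π.fixedPoints H) ≠ ⊥ := by
    intro h
    rw [h, finrank_bot] at hM
    exact Nat.not_succ_le_zero 0 hM
  obtain ⟨x, hx, hx0⟩ := (Submodule.ne_bot_iff _).1 hM0
  obtain ⟨v, hv, rfl⟩ := Submodule.mem_map.1 hx
  refine ⟨_, hx0, fun u hu => ?_⟩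
  rw [jacquetGL_leviProjection_diagGL2_mk, (π.mem_fixedPoints H v).1 hv _ ((hH _).2 ⟨u, hu, rfl⟩)]

/-- **`deg L(s, π × χ⁻¹) ≥ 1` gives a non-zero `(d(𝒪ˣ, 1), χ)`-eigenclass in the Jacquet module.**
`L(s, π × χ⁻¹) = L(s, (π ⊗ χ⁻¹∘det) × 1)` (`hasRSLFactor_glOneRep_iff_twist`), so the pole bound for
the twist gives a vector `v` with `χ⁻¹(u) π(d(u,1)) v = v` for all units `u` and non-zero class in
the common Jacquet module (`restrictUnipotentGL_twist_det`). [cite: JacquetLanglands1970, Thm. 2.18, Prop. 3.5] -/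
theorem exists_ne_zero_jacquetGL_eq_smul_of_hasRSLFactor_glOneRep (hπ : π.IsSmooth)
    {ψ : AddChar F Circle} (hψ : ψ.IsContinuousNontrivial)
    [FiniteDimensional ℂ (Representation.restrictUnipotentGL F (id : Fin 2 → Fin 2) π).Coinvariants]
    {χ : Fˣ →* ℂˣ} (hχ : IsOpen (χ.ker : Set Fˣ))
    (hL : ∀ (ν : Measure (GL (Fin 1) F ⧸ upperUnitriangular (Fin 1) F))
      [SMulInvariantMeasure (GL (Fin 1) F) (GL (Fin 1) F ⧸ upperUnitriangular (Fin 1) F) ν]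
      [IsFiniteMeasureOnCompacts ν] [ν.IsOpenPosMeasure],
      ∃ P : ℂ[X], HasRSLFactor Nat.one_lt_two π (glOneRep χ⁻¹) ψ ν P ∧ 1 ≤ P.natDegree) :
    ∃ x : (Representation.restrictUnipotentGL F (id : Fin 2 → Fin 2) π).Coinvariants, x ≠ 0 ∧
      ∀ u : Fˣ, valuation F (u : F) = 1 →
        Representation.jacquetGL F (id : Fin 2 → Fin 2) π (leviProjection F (id : Fin 2 → Fin 2)
          ⟨diagGL2 u 1, diagGL2_mem_standardParabolicGL_fin_two u 1⟩) x = ((χ u : ℂˣ) : ℂ) • x := by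
  obtain ⟨H, hH⟩ := exists_subgroup_diagGL2_units (F := F)
  set c : GL (Fin 2) F →* ℂˣ := χ⁻¹.comp Matrix.GeneralLinearGroup.det with hc_def
  have hc : ∀ g, c g = χ⁻¹ (Matrix.GeneralLinearGroup.det g) := fun g => rfl
  have hχ' : IsOpen ((χ⁻¹).ker : Set Fˣ) := by
    have h : ((χ⁻¹).ker : Set Fˣ) = (χ.ker : Set Fˣ) := by
      ext u
      simp only [SetLike.mem_coe, MonoidHom.mem_ker, MonoidHom.inv_apply, inv_eq_one]
    rw [h]
    exact hχ
  have hπ' : (π.twist c).IsSmooth := hπ.twist (isOpen_ker_of_det hχ' hc)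
  haveI : FiniteDimensional ℂ
      (Representation.restrictUnipotentGL F (id : Fin 2 → Fin 2) (π.twist c)).Coinvariants := by
    rw [restrictUnipotentGL_twist_det π χ⁻¹ c hc]
    infer_instance
  obtain ⟨ν, hinv, hfin, hpos, hC⟩ := natDegree_le_finrank_of_hasRSLFactor (π.twist c) hπ' hψ H hH
  haveI := hinv; haveI := hfin; haveI := hpos
  obtain ⟨P, hP, hdeg⟩ := hL ν
  rw [hasRSLFactor_glOneRep_iff_twist π ν hc ψ P] at hP
  have hM := hdeg.trans (hC P hP)
  have hM0 : Submodule.map (Representation.Coinvariants.mk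
      (Representation.restrictUnipotentGL F (id : Fin 2 → Fin 2) (π.twist c))) ((π.twist c).fixedPoints H) ≠ ⊥ := by
    intro h
    rw [h, finrank_bot] at hM
    exact Nat.not_succ_le_zero 0 hM
  obtain ⟨x, hx, hx0⟩ := (Submodule.ne_bot_iff _).1 hM0
  obtain ⟨v, hv, rfl⟩ := Submodule.mem_map.1 hx
  have hv0 : Representation.Coinvariants.mk (Representation.restrictUnipotentGL F (id : Fin 2 → Fin 2) π) v ≠ 0 := by
    intro h0
    apply hx0
    rw [Representation.Coinvariants.mk_eq_zero, restrictUnipotentGL_twist_det π χ⁻¹ c hc]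
    exact (Representation.Coinvariants.mk_eq_zero _).1 h0
  refine ⟨_, hv0, fun u hu => ?_⟩
  have h1 : (π.twist c) (diagGL2 u 1) v = v :=
    ((π.twist c).mem_fixedPoints H v).1 hv _ ((hH _).2 ⟨u, hu, rfl⟩)
  rw [Representation.twist_apply, hc, det_diagGL2_one_eq, MonoidHom.inv_apply] at h1
  have h2 : π (diagGL2 u 1) v = ((χ u : ℂˣ) : ℂ) • v := by
    have h3 := congrArg (fun y => ((χ u : ℂˣ) : ℂ) • y) h1
    simp only [smul_smul, Units.val_inv_eq_inv_val, ne_eq, Units.ne_zero, not_false_eq_true,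
      mul_inv_cancel₀, one_smul] at h3
    exact h3
  rw [jacquetGL_leviProjection_diagGL2_mk, h2, map_smul]

end Eigenclasses

/-! ### The exponents of a principal series from two eigenclasses -/

section Exponents

variable {F : Type*} [Field F] [ValuativeRel F] [TopologicalSpace F] [IsNonarchimedeanLocalField F]
  {W : Type*} [AddCommGroup W] [Module ℂ W]
  (σ : Representation ℂ (Π a, GL {i // (id : Fin 2 → Fin 2) i = a} F) W)

set_option maxHeartbeats 800000 in
/-- **The exponents of `I(σ)` from a fixed class and an eigenclass.**  Let `σ` be a smooth datum
acting by scalars on the line `W` (`dim W = 1`), `χ : Fˣ → ℂˣ` with `χ(u₀) ≠ 1` for a unit `u₀`,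
and suppose the Jacquet module `I(σ)_N` of the principal series contains a non-zero class `y₁` fixed
by all `d(u, 1)`, `|u| = 1`, and a non-zero class `y₂` with `d(u,1) y₂ = χ(u) y₂`.  Then either
(I) `σ(proj d(u,1)) = 1` and `σ(proj d(1,u)) = χ(u)` for all units, or (II) `σ(proj d(u,1)) = χ(u)`
and `σ(proj d(1,u)) = 1`.  Proof: evaluation at `1` descends to `ev̄ : I(σ)_N → W` with
`ev̄(d(u,1) y) = σ(proj d(u,1)) ev̄(y)` (closed-cell exponent) and `ker ev̄` is spanned by the
classes `[Φ_{K₀,w}]` on which `d(u,1)` acts by `σ(proj d(1,u))` (open-cell exponent,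
`parabolicIndGL_diagGL2_cellSection`); `y₁, y₂` cannot both lie on the line `ker ev̄` (they are
eigenvectors of `d(u₀,1)` for the distinct eigenvalues `1, χ(u₀)`), and `ev̄ y₁ ≠ 0` gives (I),
`ev̄ y₁ = 0 ≠ ev̄ y₂` gives (II). (Bernstein–Zelevinsky 1977, Thm. 5.2; Jacquet–Langlands 1970,
Prop. 3.5.) [cite: BernsteinZelevinskyASENS1977, Thm. 5.2] [cite: JacquetLanglands1970, Prop. 3.5] -/
theorem levi_exponents_of_jacquet_eigenclasses [FiniteDimensional ℂ W] (hσ : σ.IsSmooth)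
    (hscalar : ∀ t, ∃ c : ℂ, ∀ w : W, σ t w = c • w) (hW1 : Module.finrank ℂ W = 1)
    (χ : Fˣ →* ℂˣ) {u₀ : Fˣ} (hu₀ : valuation F (u₀ : F) = 1) (hχ : χ u₀ ≠ 1)
    {y₁ y₂ : (Representation.restrictUnipotentGL F (id : Fin 2 → Fin 2) (Representation.parabolicIndGL F (id : Fin 2 → Fin 2) σ)).Coinvariants}
    (hy₁0 : y₁ ≠ 0)
    (hy₁ : ∀ u : Fˣ, valuation F (u : F) = 1 → Representation.jacquetGL F (id : Fin 2 → Fin 2) (Representation.parabolicIndGL F (id : Fin 2 → Fin 2) σ)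
      (leviProjection F (id : Fin 2 → Fin 2) ⟨diagGL2 u 1, diagGL2_mem_standardParabolicGL_fin_two u 1⟩) y₁ = y₁)
    (hy₂0 : y₂ ≠ 0)
    (hy₂ : ∀ u : Fˣ, valuation F (u : F) = 1 → Representation.jacquetGL F (id : Fin 2 → Fin 2) (Representation.parabolicIndGL F (id : Fin 2 → Fin 2) σ)
      (leviProjection F (id : Fin 2 → Fin 2) ⟨diagGL2 u 1, diagGL2_mem_standardParabolicGL_fin_two u 1⟩) y₂ = ((χ u : ℂˣ) : ℂ) • y₂) :
    (∀ u : Fˣ, valuation F (u : F) = 1 → ∀ w : W,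
        σ (leviProjection F (id : Fin 2 → Fin 2) ⟨diagGL2 u 1, diagGL2_mem_standardParabolicGL_fin_two u 1⟩) w = w ∧
        σ (leviProjection F (id : Fin 2 → Fin 2) ⟨diagGL2 1 u, diagGL2_mem_standardParabolicGL_fin_two 1 u⟩) w =
          ((χ u : ℂˣ) : ℂ) • w) ∨
      (∀ u : Fˣ, valuation F (u : F) = 1 → ∀ w : W,
        σ (leviProjection F (id : Fin 2 → Fin 2) ⟨diagGL2 u 1, diagGL2_mem_standardParabolicGL_fin_two u 1⟩) w =
          ((χ u : ℂˣ) : ℂ) • w ∧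
        σ (leviProjection F (id : Fin 2 → Fin 2) ⟨diagGL2 1 u, diagGL2_mem_standardParabolicGL_fin_two 1 u⟩) w = w) := by
  obtain ⟨hK₀o, hK₀c⟩ := isOpen_isCompact_comap_glInt_oppositeCellRadical (F := F)
  set K₀ : Subgroup ↥(oppositeCellRadical (K := F) (id : Fin 2 → Fin 2)) :=
    (glInt 2 F).comap (oppositeCellRadical (K := F) (id : Fin 2 → Fin 2)).subtype with hK₀_def
  have hK₀ : ∀ x, x ∈ K₀ ↔ (x : GL (Fin 2) F) ∈ glInt 2 F := fun x => Iff.rfl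
  obtain ⟨evJ, hevJ⟩ := exists_coinvariants_eval σ
  -- the two scalars `c₁(u) = σ(proj d(u,1))`, `c₂(u) = σ(proj d(1,u))`
  choose c₁ hc₁ using fun u : Fˣ => hscalar (leviProjection F (id : Fin 2 → Fin 2)
    ⟨diagGL2 u 1, diagGL2_mem_standardParabolicGL_fin_two u 1⟩)
  choose c₂ hc₂ using fun u : Fˣ => hscalar (leviProjection F (id : Fin 2 → Fin 2)
    ⟨diagGL2 1 u, diagGL2_mem_standardParabolicGL_fin_two 1 u⟩)
  -- E1 (closed cell): `ev̄ (d(u,1) y) = c₁(u) ev̄ y`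
  have hE1 : ∀ u : Fˣ, valuation F (u : F) = 1 → ∀ y,
      evJ (Representation.jacquetGL F (id : Fin 2 → Fin 2) (Representation.parabolicIndGL F (id : Fin 2 → Fin 2) σ)
        (leviProjection F (id : Fin 2 → Fin 2) ⟨diagGL2 u 1, diagGL2_mem_standardParabolicGL_fin_two u 1⟩) y) =
      c₁ u • evJ y := by
    intro u hu y
    obtain ⟨g, rfl⟩ := Representation.Coinvariants.mk_surjective _ y
    rw [jacquetGL_leviProjection_diagGL2_mk, hevJ, hevJ]
    refine (toFun_one_parabolicIndGL_parabolic σ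
      ⟨diagGL2 u 1, diagGL2_mem_standardParabolicGL_fin_two u 1⟩ g).trans ?_
    rw [Representation.twist_apply, rootDeltaChar_standardParabolicGL_eq_one_of_mem_glInt _
        (diagGL2_mem_glInt hu (by rw [Units.val_one, map_one])), Units.val_one, one_smul,
      MonoidHom.comp_apply, hc₁]
  -- E2 (open cell): on `ker ev̄`, `d(u,1)` acts by `c₂(u)`
  have hE2 : ∀ u : Fˣ, valuation F (u : F) = 1 → ∀ y, evJ y = 0 →
      Representation.jacquetGL F (id : Fin 2 → Fin 2) (Representation.parabolicIndGL F (id : Fin 2 → Fin 2) σ)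
        (leviProjection F (id : Fin 2 → Fin 2) ⟨diagGL2 u 1, diagGL2_mem_standardParabolicGL_fin_two u 1⟩) y =
      c₂ u • y := by
    intro u hu y hy
    obtain ⟨w₁, hw₁⟩ := ker_eval_le_range σ hσ K₀ hK₀o hK₀c hevJ (LinearMap.mem_ker.2 hy)
    rw [← hw₁, LinearMap.comp_apply, cellSectionₗ_apply, jacquetGL_leviProjection_diagGL2_mk,
      parabolicIndGL_diagGL2_cellSection σ hσ K₀ hK₀ hK₀o hK₀c hu, Representation.twist_apply,
      rootDeltaChar_standardParabolicGL_eq_one_of_mem_glInt _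
        (diagGL2_mem_glInt (by rw [Units.val_one, map_one]) hu),
      Units.val_one, one_smul, MonoidHom.comp_apply, hc₂, ← cellSectionₗ_apply, map_smul, map_smul,
      cellSectionₗ_apply]
  by_cases h1 : evJ y₁ = 0
  · -- case (II): `y₁` spans the line `ker ev̄`
    right
    have h2 : evJ y₂ ≠ 0 := by
      intro h2
      obtain ⟨w₁, hw₁⟩ := ker_eval_le_range σ hσ K₀ hK₀o hK₀c hevJ (LinearMap.mem_ker.2 h1)
      obtain ⟨w₂, hw₂⟩ := ker_eval_le_range σ hσ K₀ hK₀o hK₀c hevJ (LinearMap.mem_ker.2 h2)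
      have hw₂0 : w₂ ≠ 0 := by
        rintro rfl
        rw [map_zero] at hw₂
        exact hy₂0 hw₂.symm
      obtain ⟨a, ha⟩ := (finrank_eq_one_iff_of_nonzero' w₂ hw₂0).1 hW1 w₁
      have hy : y₁ = a • y₂ := by rw [← hw₁, ← hw₂, ← ha, map_smul]
      have e1 := hy₁ u₀ hu₀
      rw [hy, map_smul, hy₂ u₀ hu₀, smul_smul] at e1
      have e2 : (a * (((χ u₀ : ℂˣ) : ℂ) - 1)) • y₂ = 0 := by
        rw [mul_sub, mul_one, sub_smul, e1, sub_self]
      rcases smul_eq_zero.1 e2 with h | h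
      · rcases mul_eq_zero.1 h with h' | h'
        · apply hy₁0
          rw [hy, h', zero_smul]
        · exact hχ (Units.val_eq_one.1 (sub_eq_zero.1 h'))
      · exact hy₂0 h
    intro u hu
    have hc₂1 : c₂ u = 1 := by
      have e := hE2 u hu y₁ h1
      rw [hy₁ u hu] at e
      have e2 : (c₂ u - 1) • y₁ = 0 := by rw [sub_smul, one_smul, ← e, sub_self]
      rcases smul_eq_zero.1 e2 with h | h
      · exact sub_eq_zero.1 h
      · exact absurd h hy₁0
    have hc₁χ : c₁ u = ((χ u : ℂˣ) : ℂ) := by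
      have e := hE1 u hu y₂
      rw [hy₂ u hu, map_smul] at e
      have e2 : (((χ u : ℂˣ) : ℂ) - c₁ u) • evJ y₂ = 0 := by rw [sub_smul, e, sub_self]
      rcases smul_eq_zero.1 e2 with h | h
      · exact (sub_eq_zero.1 h).symm
      · exact absurd h h2
    intro w
    exact ⟨by rw [hc₁, hc₁χ], by rw [hc₂, hc₂1, one_smul]⟩
  · -- case (I): `ev̄ y₁ ≠ 0`
    left
    have hc₁1 : ∀ u : Fˣ, valuation F (u : F) = 1 → c₁ u = 1 := by
      intro u hu
      have e := hE1 u hu y₁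
      rw [hy₁ u hu] at e
      have e2 : (c₁ u - 1) • evJ y₁ = 0 := by rw [sub_smul, one_smul, ← e, sub_self]
      rcases smul_eq_zero.1 e2 with h | h
      · exact sub_eq_zero.1 h
      · exact absurd h h1
    have h2 : evJ y₂ = 0 := by
      have e := hE1 u₀ hu₀ y₂
      rw [hy₂ u₀ hu₀, map_smul, hc₁1 u₀ hu₀, one_smul] at e
      have e2 : (((χ u₀ : ℂˣ) : ℂ) - 1) • evJ y₂ = 0 := by rw [sub_smul, one_smul, e, sub_self]
      rcases smul_eq_zero.1 e2 with h | h
      · exact absurd (Units.val_eq_one.1 (sub_eq_zero.1 h)) hχ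
      · exact h
    have hc₂χ : ∀ u : Fˣ, valuation F (u : F) = 1 → c₂ u = ((χ u : ℂˣ) : ℂ) := by
      intro u hu
      have e := hE2 u hu y₂ h2
      rw [hy₂ u hu] at e
      have e2 : (((χ u : ℂˣ) : ℂ) - c₂ u) • y₂ = 0 := by rw [sub_smul, e, sub_self]
      rcases smul_eq_zero.1 e2 with h | h
      · exact (sub_eq_zero.1 h).symm
      · exact absurd h hy₂0
    intro u hu w
    exact ⟨by rw [hc₁, hc₁1 u hu, one_smul], by rw [hc₂, hc₂χ u hu]⟩

end Exponents

/-- **Registered sub-goal `stub_local1951_reptheory_exponents` (closed form of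
`levi_exponents_of_jacquet_eigenclasses`)**: the exponents of a principal series `I(σ)` of
`GL₂(F)` whose Jacquet module contains a non-zero `d(𝒪ˣ,1)`-fixed class and a non-zero
`(d(𝒪ˣ,1), χ)`-eigenclass, `χ(u₀) ≠ 1`, are `{1, χ}` on `𝒪ˣ` in one of the two orders.
[cite: JacquetLanglands1970, Prop. 3.5] [cite: BernsteinZelevinskyASENS1977, Thm. 5.2] -/
theorem stub_local1951_reptheory_exponents : ∀ (F : Type) [Field F] [ValuativeRel F] [TopologicalSpace F] [IsNonarchimedeanLocalField F] (W : Type) [AddCommGroup W] [Module ℂ W] [FiniteDimensional ℂ W] (σ : Representation ℂ (Π a, GL {i // (id : Fin 2 → Fin 2) i = a} F) W), σ.IsSmooth → (∀ t, ∃ c : ℂ, ∀ w : W, σ t w = c • w) → Module.finrank ℂ W = 1 → ∀ (χ : Fˣ →* ℂˣ) (u₀ : Fˣ), valuation F (u₀ : F) = 1 → χ u₀ ≠ 1 → ∀ (y₁ y₂ : (Representation.restrictUnipotentGL F (id : Fin 2 → Fin 2) (Representation.parabolicIndGL F (id : Fin 2 → Fin 2) σ)).Coinvariants), y₁ ≠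 0 → (∀ u : Fˣ, valuation F (u : F) = 1 → Representation.jacquetGL F (id : Fin 2 → Fin 2) (Representation.parabolicIndGL F (id : Fin 2 → Fin 2) σ) (leviProjection F (id : Fin 2 → Fin 2) ⟨diagGL2 u 1, diagGL2_mem_standardParabolicGL_fin_two u 1⟩) y₁ = y₁) → y₂ ≠ 0 → (∀ u : Fˣ, valuation F (u : F) = 1 → Representation.jacquetGL F (id : Fin 2 → Fin 2) (Representation.parabolicIndGL F (id : Fin 2 → Fin 2) σ) (leviProjection F (id : Fin 2 → Fin 2) ⟨diagGL2 u 1, diagGL2_mem_standardParabolicGL_fin_two u 1⟩) y₂ = ((χ u : ℂˣ) : ℂ) • y₂) → (∀ u : Fˣ, valuation F (u : F) = 1 → ∀ w : W, σ (leviProjection F (id : Fin 2 → Fin 2) ⟨diagGL2 u 1, diagGL2_mem_standardParabolicGL_fin_two u 1⟩) w = w ∧ σ (leviProjection F (id : Fin 2 → Fin 2) ⟨diagGL2 1 u, diagGL2_mem_standardParabolicGL_fin_two 1 u⟩) w = ((χ u : ℂˣ) : ℂ) • w) ∨ (∀ u : Fˣ, valuation F (u : F) = 1 → ∀ w : W,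 σ (leviProjection F (id : Fin 2 → Fin 2) ⟨diagGL2 u 1, diagGL2_mem_standardParabolicGL_fin_two u 1⟩) w = ((χ u : ℂˣ) : ℂ) • w ∧ σ (leviProjection F (id : Fin 2 → Fin 2) ⟨diagGL2 1 u, diagGL2_mem_standardParabolicGL_fin_two 1 u⟩) w = w) := by
  intro F _ _ _ _ W _ _ _ σ hσ hscalar hW1 χ u₀ hu₀ hχ y₁ y₂ hy₁0 hy₁ hy₂0 hy₂
  exact levi_exponents_of_jacquet_eigenclasses σ hσ hscalar hW1 χ hu₀ hχ hy₁0 hy₁ hy₂0 hy₂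

end Summit.Langlands.Langlands.Theorems.CorrespondentFingerprint

end
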